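import Literature.Analysis.OperatorTheory.PositiveKernelSpectralTrace
import Literature.Analysis.OperatorTheory.KernelCyclicPeeling
import HarnessLib

/-!
# Spectral trace formula for two bond insertions in the cyclic integral of a positive Hilbert–Schmidt kernel

Continuation of `PositiveKernelSpectralTrace.lean` (same setting: bounded symmetric kernel `K` on a finite measure
space, its `L²` operator `A`, a countable Hilbert basis of eigenvectors `A bᵢ = λᵢ bᵢ`): the double spectral sum
for the nested integral produced by `HeterogeneousCyclicPeeling.integral_cyclic_insert_two`,

  `∫∫ X(x,y) (κ^[a+2] (z ↦ ∫ X'(z,w) (κ^[b+1] K(·,x))(w)))(y) dμ(y) dμ(x)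
     = Σ_{(i,j)} λⱼ^{a+2} λᵢ^{b+2} ⟪bᵢ, 𝒳 bⱼ⟫ ⟪bⱼ, 𝒳' bᵢ⟫`   (`Tr(𝒳 A^{a+2} 𝒳' A^{b+2})`),

the second-moment (two-point) trace formula of the transfer-matrix method (`hasSum_integral_iterate_insert_two`),
after the abstract double Parseval identity `⟪w, T v⟫ = Σ_{(i,j)} ⟪bᵢ, v⟫ ⟪w, bⱼ⟫ ⟪bⱼ, T bᵢ⟫` for a summable double
family (`hasSum_inner_apply_prod`); and the periodic path-integral form of the trace of powers,
`∫ ∏_{t : Fin (M+2)} K(V t, V (t+1)) dμ^{⊗(M+2)} = Σᵢ λᵢ^{M+2}` for non-negative eigenvalues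
(`hasSum_pow_integral_cyclic`, from `hasSum_pow_integral_iterate_diag` and `KernelCyclicPeeling`).
Mathlib + companions only; no definitions.
References: B. Simon, *Trace Ideals and Their Applications* (2005), Ch. 3; M. Reed, B. Simon, *Methods of Modern
Mathematical Physics I* (1980), §VI.6. [folklore]
-/

noncomputable section

open MeasureTheory Filter Set Function
open scoped RealInnerProductSpace ENNReal

namespace Literature.Analysis.OperatorTheory

variable {X : Type*} [MeasurableSpace X] {μ : Measure X} [IsFiniteMeasure μ]
  {K : X → X → ℝ} {C : ℝ} {A : Lp ℝ 2 μ →L[ℝ] Lp ℝ 2 μ} {ι : Type*}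
  {b : HilbertBasis ι ℝ (Lp ℝ 2 μ)} {lam : ι → ℝ}

/-! ### Two bond insertions -/

/-- **Double Parseval through a bounded operator.**  For a Hilbert basis `(bᵢ)`, a bounded `T` and vectors
`v, w`: `⟪w, T v⟫ = Σ_{(i,j)} ⟪bᵢ, v⟫ ⟪w, bⱼ⟫ ⟪bⱼ, T bᵢ⟫` as a sum over `ι × ι`, PROVIDED the double family is
summable (it need not be absolutely summable in general; the expansion of `v`, continuity of `T` and of
`⟪w, ·⟫`, Parseval for `T bᵢ`, and `HasSum.prod_fiberwise`). [folklore] -/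
theorem hasSum_inner_apply_prod {E : Type*} [NormedAddCommGroup E] [InnerProductSpace ℝ E] [CompleteSpace E]
    {ι' : Type*} (b : HilbertBasis ι' ℝ E) (T : E →L[ℝ] E) (v w : E)
    (hs : Summable fun p : ι' × ι' => ⟪b p.1, v⟫ * (⟪w, b p.2⟫ * ⟪b p.2, T (b p.1)⟫)) :
    HasSum (fun p : ι' × ι' => ⟪b p.1, v⟫ * (⟪w, b p.2⟫ * ⟪b p.2, T (b p.1)⟫)) ⟪w, T v⟫ := by
  have hv : HasSum (fun i => ⟪b i, v⟫ • b i) v := by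
    simpa only [HilbertBasis.repr_apply_apply] using b.hasSum_repr v
  have hTv : HasSum (fun i => ⟪b i, v⟫ • T (b i)) (T v) := by
    simpa only [map_smul] using hv.mapL T
  have hg : HasSum (fun i => ⟪b i, v⟫ * ⟪w, T (b i)⟫) ⟪w, T v⟫ := by
    have h := hTv.mapL (innerSL ℝ w)
    simpa only [innerSL_apply_apply, real_inner_smul_right] using h
  have hfib : ∀ i, HasSum (fun j => ⟪b i, v⟫ * (⟪w, b j⟫ * ⟪b j, T (b i)⟫)) (⟪b i, v⟫ * ⟪w, T (b i)⟫) :=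
    fun i => (b.hasSum_inner_mul_inner w (T (b i))).mul_left _
  have h2 := hs.hasSum.prod_fiberwise hfib
  rw [hg.unique h2]
  exact hs.hasSum

/-- Summability of a product family on `ι × ι` dominated by a product of two summable non-negative families.
[folklore] -/
theorem summable_prod_of_le_mul {f : ι × ι → ℝ} {g h : ι → ℝ} (hg : Summable g) (hh : Summable h)
    (hg0 : ∀ i, 0 ≤ g i) (hh0 : ∀ i, 0 ≤ h i) (hf : ∀ p, |f p| ≤ g p.1 * h p.2) : Summable f := by
  have hprod : Summable fun p : ι × ι => g p.1 * h p.2 := hg.mul_of_nonneg hh hg0 hh0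
  exact (Summable.of_norm_bounded hprod fun p => by rw [Real.norm_eq_abs]; exact hf p)

set_option maxHeartbeats 400000 in
/-- **Two bond insertions.**  For two further bounded kernels `X, X'` with `L²` operators `𝒳, 𝒳'`, the nested
integral produced by `integral_cyclic_insert_two` is the double spectral sum
`∫∫ X(x,y) (κ^[a+2] (z ↦ ∫ X'(z,w) (κ^[b+1] K(·,x))(w)))(y) dμ(y) dμ(x)
   = Σ_{(i,j)} λⱼ^{a+2} λᵢ^{b+2} ⟪bᵢ, 𝒳 bⱼ⟫ ⟪bⱼ, 𝒳' bᵢ⟫`  (`Tr(𝒳 A^{a+2} 𝒳' A^{b+2})`). [folklore] -/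
theorem hasSum_integral_iterate_insert_two [Countable ι] (hK : StronglyMeasurable (uncurry K))
    (hC : ∀ x y, ‖K x y‖ ≤ C) (hsymm : ∀ x y, K x y = K y x)
    (hA : ∀ φ : Lp ℝ 2 μ, (A φ : X → ℝ) =ᵐ[μ] fun x => ∫ y, K x y * φ y ∂μ)
    (hb : ∀ i, A (b i) = lam i • b i) {Xk : X → X → ℝ} {CX : ℝ} (hX : StronglyMeasurable (uncurry Xk))
    (hCX : ∀ x y, ‖Xk x y‖ ≤ CX) {Xop : Lp ℝ 2 μ →L[ℝ] Lp ℝ 2 μ}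
    (hXop : ∀ φ : Lp ℝ 2 μ, (Xop φ : X → ℝ) =ᵐ[μ] fun x => ∫ y, Xk x y * φ y ∂μ)
    {Xk' : X → X → ℝ} {CX' : ℝ} (hX' : StronglyMeasurable (uncurry Xk')) (hCX' : ∀ x y, ‖Xk' x y‖ ≤ CX')
    {Xop' : Lp ℝ 2 μ →L[ℝ] Lp ℝ 2 μ} (hXop' : ∀ φ : Lp ℝ 2 μ, (Xop' φ : X → ℝ) =ᵐ[μ] fun x => ∫ y, Xk' x y * φ y ∂μ)
    (a b' : ℕ) :
    HasSum (fun p : ι × ι => lam p.2 ^ (a + 2) * lam p.1 ^ (b' + 2) * ⟪b p.1, Xop (b p.2)⟫ * ⟪b p.2, Xop' (b p.1)⟫)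
      (∫ x, ∫ y, Xk x y * ((fun f : X → ℝ => fun w => ∫ z, K w z * f z ∂μ)^[a + 2]
        (fun z => ∫ w, Xk' z w * ((fun f : X → ℝ => fun w => ∫ z, K w z * f z ∂μ)^[b' + 1] (fun v => K v x)) w ∂μ))
          y ∂μ ∂μ) := by
  -- notation
  set κ : (X → ℝ) → X → ℝ := fun f w => ∫ z, K w z * f z ∂μ with hκ
  set c : ι → X → ℝ := fun i x => ∫ z, K x z * b i z ∂μ with hc
  set d : ι → X → ℝ := fun i x => ∫ y, Xk x y * c i y ∂μ with hd
  set kx : X → Lp ℝ 2 μ := fun x => (memLp_kernel_section (μ := μ) hK hC x).toLp (K x) with hkx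
  set T : Lp ℝ 2 μ →L[ℝ] Lp ℝ 2 μ := (A ^ (a + 1)).comp (Xop'.comp (A ^ (b' + 1))) with hT
  set Tm : ι × ι → ℝ := fun p => ⟪b p.2, T (b p.1)⟫ with hTm
  have hcm : ∀ i, Measurable (c i) := fun i => measurable_integral_kernel_mul_basis hK b i
  have hdm : ∀ i, Measurable (d i) := fun i => measurable_integral_kernel_mul_fun hX (hcm i)
  have hlamA : ∀ i, |lam i| ≤ ‖A‖ := abs_lam_le_norm hb
  have hpars : ∀ x, Summable (fun i => c i x ^ 2) ∧ ∑' i, c i x ^ 2 ≤ C ^ 2 * μ.real univ :=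
    fun x => tsum_sq_integral_kernel_mul_le hK hC b x
  have hsq_meas : Measurable fun x => ∫ z, ‖K x z‖ ^ 2 ∂μ := (stronglyMeasurable_integral_norm_kernel_sq hK).measurable
  have hsq_eq : ∀ x, ∑' i, c i x ^ 2 = ∫ z, ‖K x z‖ ^ 2 ∂μ := fun x =>
    (hasSum_norm_sq_integral_kernel_mul (𝕜 := ℝ) hK hC b x |>.tsum_eq |> fun h => by
      simpa only [Real.norm_eq_abs, sq_abs] using h)
  have hlam2 : Summable fun i => lam i ^ 2 := (hasSum_lam_sq hK hC hA hb).summable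
  have hae : ∀ i, (A (b i) : X → ℝ) =ᵐ[μ] c i := fun i => hA (b i)
  have hcoef : ∀ x i, ⟪b i, kx x⟫ = c i x := fun x i => by
    rw [real_inner_comm]; exact inner_kernel_section_basis hK hC b x i
  -- the matrix of `T`
  have hsa : ∀ j : ℕ, IsSelfAdjoint (A ^ j) := fun j => (isSelfAdjoint_kernelOp hK hC hsymm hA).pow j
  have hTm_eq : ∀ p : ι × ι, Tm p = lam p.2 ^ (a + 1) * lam p.1 ^ (b' + 1) * ⟪b p.2, Xop' (b p.1)⟫ := by
    intro p
    simp only [hTm, hT, ContinuousLinearMap.comp_apply]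
    rw [← (hsa (a + 1)).adjoint_eq, ContinuousLinearMap.adjoint_inner_right, pow_apply_basis hb, pow_apply_basis hb,
      map_smul, real_inner_smul_left, real_inner_smul_right]
    ring
  have hTm_le : ∀ p : ι × ι, |Tm p| ≤ ‖Xop'‖ * ‖A‖ ^ (a + b') * (|lam p.2| * |lam p.1|) := by
    intro p
    rw [hTm_eq, abs_mul, abs_mul, abs_pow, abs_pow]
    have h1 : |⟪b p.2, Xop' (b p.1)⟫| ≤ ‖Xop'‖ := by
      calc |⟪b p.2, Xop' (b p.1)⟫| ≤ ‖b p.2‖ * ‖Xop' (b p.1)‖ := abs_real_inner_le_norm _ _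
        _ ≤ 1 * (‖Xop'‖ * ‖b p.1‖) := by
            rw [b.orthonormal.norm_eq_one]; exact mul_le_mul_of_nonneg_left (Xop'.le_opNorm _) zero_le_one
        _ = ‖Xop'‖ := by rw [b.orthonormal.norm_eq_one, mul_one, one_mul]
    have h2 : |lam p.2| ^ (a + 1) ≤ ‖A‖ ^ a * |lam p.2| := by
      rw [pow_succ]; exact mul_le_mul_of_nonneg_right (pow_le_pow_left₀ (abs_nonneg _) (hlamA _) a) (abs_nonneg _)
    have h3 : |lam p.1| ^ (b' + 1) ≤ ‖A‖ ^ b' * |lam p.1| := by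
      rw [pow_succ]; exact mul_le_mul_of_nonneg_right (pow_le_pow_left₀ (abs_nonneg _) (hlamA _) b') (abs_nonneg _)
    calc |lam p.2| ^ (a + 1) * |lam p.1| ^ (b' + 1) * |⟪b p.2, Xop' (b p.1)⟫|
        ≤ ‖A‖ ^ a * |lam p.2| * (‖A‖ ^ b' * |lam p.1|) * ‖Xop'‖ := by gcongr
      _ = ‖Xop'‖ * ‖A‖ ^ (a + b') * (|lam p.2| * |lam p.1|) := by rw [pow_add]; ring
  -- (A) the nested inner function is an inner product of sections: `(κ^[a+2] F_x)(y) = ⟪k_y, T k_x⟫`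
  have hstepA : ∀ x y, (κ^[a + 2] (fun z => ∫ w, Xk' z w * (κ^[b' + 1] (fun v => K v x)) w ∂μ)) y =
      ⟪kx y, T (kx x)⟫ := by
    intro x y
    have hKx : (fun v => K v x) = K x := funext fun v => hsymm v x
    have hKxm : Measurable (K x) := hK.measurable.of_uncurry_left
    obtain ⟨⟨B, hB⟩, hGm⟩ := exists_bound_and_measurable_kernelIterate (μ := μ) hK hC hKxm ⟨C, fun v => hC x v⟩
      (b' + 1)
    rw [hKx]
    set G : X → ℝ := κ^[b' + 1] (K x) with hG
    set F : X → ℝ := fun z => ∫ w, Xk' z w * G w ∂μ with hF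
    have hFm : Measurable F := measurable_integral_kernel_mul_fun hX' hGm.measurable
    have hFb : ∀ z, ‖F z‖ ≤ CX' * (B * μ.real univ) := fun z => by
      calc ‖∫ w, Xk' z w * G w ∂μ‖ ≤ ∫ w, ‖Xk' z w * G w‖ ∂μ := norm_integral_le_integral_norm _
        _ ≤ ∫ _w, CX' * B ∂μ := by
            refine integral_mono_of_nonneg (Eventually.of_forall fun w => norm_nonneg _)
              (integrable_const _) (Eventually.of_forall fun w => ?_)
            dsimp only
            rw [norm_mul]
            exact mul_le_mul (hCX' z w) (hB w) (norm_nonneg _) ((norm_nonneg _).trans (hCX' z w))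
        _ = CX' * (B * μ.real univ) := by rw [integral_const, smul_eq_mul]; ring
    -- the class of `G` is `A^{b'+1} k_x`, the class of `F` is `𝒳' (A^{b'+1} k_x)`
    have hGcl : ((A ^ (b' + 1)) (kx x) : X → ℝ) =ᵐ[μ] G :=
      pow_kernelOp_toLp_ae_eq_iterate (μ := μ) hA hKxm (fun v => hC x v) (b' + 1)
    have hFcl : (memLp_two_of_bound (μ := μ) hFm hFb).toLp F = Xop' ((A ^ (b' + 1)) (kx x)) := by
      refine Lp.ext ((MemLp.coeFn_toLp _).trans (EventuallyEq.trans (Eventually.of_forall fun z => ?_)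
        (hXop' _).symm))
      exact integral_congr_ae (by filter_upwards [hGcl] with w hw; rw [hw])
    have h1 := inner_kernel_section_pow_kernelOp hK hC hsymm hA hFm hFb (a + 1) y
    rw [hFcl] at h1
    rw [← h1]
    simp only [hkx, hT, ContinuousLinearMap.comp_apply]
  -- (B) the double expansion `⟪k_y, T k_x⟫ = Σ_{(i,j)} cᵢ(x) cⱼ(y) T_{ji}`
  set gx : X → ι → ℝ := fun x i => ‖Xop'‖ * ‖A‖ ^ (a + b') * ((c i x ^ 2 + lam i ^ 2) / 2) with hgx
  set hy : X → ι → ℝ := fun y j => (c j y ^ 2 + lam j ^ 2) / 2 with hhy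
  have hgx_s : ∀ x, Summable (gx x) := fun x => (((hpars x).1.add hlam2).div_const 2).mul_left _
  have hhy_s : ∀ y, Summable (hy y) := fun y => ((hpars y).1.add hlam2).div_const 2
  have hgx0 : ∀ x i, 0 ≤ gx x i := fun x i => by positivity
  have hhy0 : ∀ y j, 0 ≤ hy y j := fun y j => by positivity
  have hterm_le : ∀ x y (p : ι × ι), |c p.1 x * (c p.2 y * Tm p)| ≤ gx x p.1 * hy y p.2 := by
    intro x y p
    rw [abs_mul, abs_mul]
    have h1 := hTm_le p
    have h2 : |c p.1 x| * |lam p.1| ≤ (c p.1 x ^ 2 + lam p.1 ^ 2) / 2 := by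
        have hsq := two_mul_le_add_sq |c p.1 x| |lam p.1|
        rw [sq_abs, sq_abs] at hsq
        linarith
    have h3 : |c p.2 y| * |lam p.2| ≤ (c p.2 y ^ 2 + lam p.2 ^ 2) / 2 := by
        have hsq := two_mul_le_add_sq |c p.2 y| |lam p.2|
        rw [sq_abs, sq_abs] at hsq
        linarith
    calc |c p.1 x| * (|c p.2 y| * |Tm p|)
        ≤ |c p.1 x| * (|c p.2 y| * (‖Xop'‖ * ‖A‖ ^ (a + b') * (|lam p.2| * |lam p.1|))) := by gcongr
      _ = ‖Xop'‖ * ‖A‖ ^ (a + b') * (|c p.1 x| * |lam p.1|) * (|c p.2 y| * |lam p.2|) := by ring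
      _ ≤ ‖Xop'‖ * ‖A‖ ^ (a + b') * ((c p.1 x ^ 2 + lam p.1 ^ 2) / 2) * ((c p.2 y ^ 2 + lam p.2 ^ 2) / 2) := by
          gcongr
  have hstepB : ∀ x y, HasSum (fun p : ι × ι => c p.1 x * (c p.2 y * Tm p)) ⟪kx y, T (kx x)⟫ := by
    intro x y
    have hs : Summable fun p : ι × ι => c p.1 x * (c p.2 y * Tm p) :=
      summable_prod_of_le_mul (hgx_s x) (hhy_s y) (hgx0 x) (hhy0 y) (hterm_le x y)
    have hcoef' : ∀ j, ⟪kx y, b j⟫ = c j y := fun j => inner_kernel_section_basis hK hC b y j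
    have h := hasSum_inner_apply_prod b T (kx x) (kx y)
    simp only [hcoef, hcoef'] at h
    exact h hs
  -- (C) level one: for each `x`, the `y`-integral commutes with the double sum
  have hlev1 : ∀ x, HasSum (fun p : ι × ι => c p.1 x * Tm p * d p.2 x)
      (∫ y, Xk x y * (κ^[a + 2] (fun z => ∫ w, Xk' z w * (κ^[b' + 1] (fun v => K v x)) w ∂μ)) y ∂μ) := by
    intro x
    have hCX0 : 0 ≤ CX := (norm_nonneg _).trans (hCX x x)
    have key := hasSum_integral_of_dominated_convergence (μ := μ)
      (F := fun (p : ι × ι) y => Xk x y * (c p.1 x * (c p.2 y * Tm p)))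
      (f := fun y => Xk x y * (κ^[a + 2] (fun z => ∫ w, Xk' z w * (κ^[b' + 1] (fun v => K v x)) w ∂μ)) y)
      (fun p y => CX * (gx x p.1 * hy y p.2)) (fun p => ?_) (fun p => ?_) ?_ ?_
      (Eventually.of_forall fun y => by rw [hstepA x y]; exact (hstepB x y).mul_left _)
    · refine key.congr_fun fun p => ?_
      simp only [hd]
      rw [← integral_const_mul]
      refine integral_congr_ae (Eventually.of_forall fun y => ?_)
      ring
    · exact ((hX.measurable.of_uncurry_left).mul ((((hcm p.2).mul_const _)).const_mul _)).aestronglyMeasurable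
    · refine Eventually.of_forall fun y => ?_
      rw [norm_mul, Real.norm_eq_abs, Real.norm_eq_abs]
      have h1 : |Xk x y| ≤ CX := by simpa [Real.norm_eq_abs] using hCX x y
      exact mul_le_mul h1 (hterm_le x y p) (abs_nonneg _) hCX0
    · exact Eventually.of_forall fun y => ((hgx_s x).mul_of_nonneg (hhy_s y) (hgx0 x) (hhy0 y)).mul_left CX
    · have hfun : (fun y => ∑' p : ι × ι, CX * (gx x p.1 * hy y p.2)) =
          fun y => CX * ((∑' i, gx x i) * ((∫ z, ‖K y z‖ ^ 2 ∂μ + ∑' i, lam i ^ 2) / 2)) := by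
        funext y
        rw [tsum_mul_left, ← (hgx_s x).tsum_mul_tsum (hhy_s y) ((hgx_s x).mul_of_nonneg (hhy_s y) (hgx0 x) (hhy0 y))]
        simp only [hhy]
        rw [tsum_div_const, (hpars y).1.tsum_add hlam2, hsq_eq y]
      rw [hfun]
      exact (((Integrable.of_bound hsq_meas.aestronglyMeasurable (C ^ 2 * μ.real univ)
        (Eventually.of_forall fun y => by
          rw [Real.norm_eq_abs, abs_of_nonneg (integral_nonneg fun z => by positivity), ← hsq_eq y]
          exact (hpars y).2)).add (integrable_const _)).div_const 2 |>.const_mul _) |>.const_mul _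
  -- (D) the terms of level two
  have hdb : ∀ i x, |d i x| ≤ CX * Real.sqrt (μ.real univ) * |lam i| := by
    intro i x
    have hCX0 : 0 ≤ CX := (norm_nonneg _).trans (hCX x x)
    have h1 : d i x = ∫ y, Xk x y * (A (b i)) y ∂μ := by
      simp only [hd]
      exact integral_congr_ae (by filter_upwards [hae i] with y hy; rw [hy])
    rw [h1]
    refine (abs_integral_kernel_mul_le hCX hCX0 (A (b i)) x).trans (le_of_eq ?_)
    rw [hb, norm_smul, Real.norm_eq_abs, b.orthonormal.norm_eq_one i, mul_one]
  have hterm : ∀ p : ι × ι, ∫ x, c p.1 x * Tm p * d p.2 x ∂μ =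
      lam p.2 ^ (a + 2) * lam p.1 ^ (b' + 2) * ⟪b p.1, Xop (b p.2)⟫ * ⟪b p.2, Xop' (b p.1)⟫ := by
    intro p
    have h1 : ∫ x, c p.1 x * d p.2 x ∂μ = ⟪A (b p.1), Xop (A (b p.2))⟫ := by
      rw [inner_kernelOp_eq_integral hXop]
      refine integral_congr_ae ?_
      filter_upwards [hae p.1] with x hx
      rw [hx]
      simp only [hd]
      congr 1
      exact integral_congr_ae (by filter_upwards [hae p.2] with y hy; rw [hy])
    calc ∫ x, c p.1 x * Tm p * d p.2 x ∂μ = Tm p * ∫ x, c p.1 x * d p.2 x ∂μ := by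
          rw [← integral_const_mul]
          exact integral_congr_ae (Eventually.of_forall fun x => by ring)
      _ = lam p.2 ^ (a + 2) * lam p.1 ^ (b' + 2) * ⟪b p.1, Xop (b p.2)⟫ * ⟪b p.2, Xop' (b p.1)⟫ := by
          rw [h1, hb, hb, map_smul, real_inner_smul_left, real_inner_smul_right, hTm_eq]
          ring
  -- (E) level two: the `x`-integral commutes with the double sum
  set Kc : ℝ := CX * Real.sqrt (μ.real univ) * ‖Xop'‖ * ‖A‖ ^ (a + b') with hKc
  have hlev2 : HasSum (fun p : ι × ι => ∫ x, c p.1 x * Tm p * d p.2 x ∂μ)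
      (∫ x, ∫ y, Xk x y * (κ^[a + 2] (fun z => ∫ w, Xk' z w * (κ^[b' + 1] (fun v => K v x)) w ∂μ)) y ∂μ ∂μ) := by
    refine hasSum_integral_of_dominated_convergence (μ := μ)
      (F := fun (p : ι × ι) x => c p.1 x * Tm p * d p.2 x)
      (fun p x => Kc * (hy x p.1 * lam p.2 ^ 2))
      (fun p => (((hcm p.1).mul_const _).mul (hdm p.2)).aestronglyMeasurable) (fun p => ?_) ?_ ?_
      (Eventually.of_forall fun x => hlev1 x)
    · refine Eventually.of_forall fun x => ?_
      rw [Real.norm_eq_abs, abs_mul, abs_mul]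
      have hCX0 : 0 ≤ CX := (norm_nonneg _).trans (hCX x x)
      have h2 : |c p.1 x| * |lam p.1| ≤ hy x p.1 := by
        show |c p.1 x| * |lam p.1| ≤ (c p.1 x ^ 2 + lam p.1 ^ 2) / 2
        have hsq := two_mul_le_add_sq |c p.1 x| |lam p.1|
        rw [sq_abs, sq_abs] at hsq
        linarith
      calc |c p.1 x| * |Tm p| * |d p.2 x|
          ≤ |c p.1 x| * (‖Xop'‖ * ‖A‖ ^ (a + b') * (|lam p.2| * |lam p.1|)) *
              (CX * Real.sqrt (μ.real univ) * |lam p.2|) := by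
            gcongr
            exacts [hTm_le p, hdb p.2 x]
        _ = Kc * ((|c p.1 x| * |lam p.1|) * |lam p.2| ^ 2) := by simp only [hKc]; ring
        _ ≤ Kc * (hy x p.1 * lam p.2 ^ 2) := by rw [sq_abs]; gcongr
    · exact Eventually.of_forall fun x =>
        ((hhy_s x).mul_of_nonneg hlam2 (hhy0 x) (fun j => sq_nonneg _)).mul_left Kc
    · have hfun : (fun x => ∑' p : ι × ι, Kc * (hy x p.1 * lam p.2 ^ 2)) =
          fun x => Kc * (((∫ z, ‖K x z‖ ^ 2 ∂μ + ∑' i, lam i ^ 2) / 2) * ∑' j, lam j ^ 2) := by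
        funext x
        rw [tsum_mul_left, ← (hhy_s x).tsum_mul_tsum hlam2 ((hhy_s x).mul_of_nonneg hlam2 (hhy0 x)
          (fun j => sq_nonneg _))]
        simp only [hhy]
        rw [tsum_div_const, (hpars x).1.tsum_add hlam2, hsq_eq x]
      rw [hfun]
      exact ((((Integrable.of_bound hsq_meas.aestronglyMeasurable (C ^ 2 * μ.real univ)
        (Eventually.of_forall fun y => by
          rw [Real.norm_eq_abs, abs_of_nonneg (integral_nonneg fun z => by positivity), ← hsq_eq y]
          exact (hpars y).2)).add (integrable_const _)).div_const 2).mul_const _).const_mul _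
  -- (F) assemble
  simpa only [hterm] using hlev2

/-! ### Trace of powers in cyclic (periodic path-integral) form -/

/-- **`Tr A^{M+2}` as a periodic path integral.**  For non-negative eigenvalues,
`∫ ∏_{t : Fin (M+2)} K(V t, V (t+1)) dμ^{⊗(M+2)}(V) = Σᵢ λᵢ^{M+2}` — the cyclic integral of `M + 2` copies of the
kernel around a cycle (`KernelCyclicPeeling.integral_cyclic_eq_integral_iterate` with trivial insertions) combined with
`hasSum_pow_integral_iterate_diag`. [folklore] -/
theorem hasSum_pow_integral_cyclic [Countable ι] (hK : StronglyMeasurable (uncurry K))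
    (hC : ∀ x y, ‖K x y‖ ≤ C) (hsymm : ∀ x y, K x y = K y x)
    (hA : ∀ φ : Lp ℝ 2 μ, (A φ : X → ℝ) =ᵐ[μ] fun x => ∫ y, K x y * φ y ∂μ)
    (hb : ∀ i, A (b i) = lam i • b i) (hlam : ∀ i, 0 ≤ lam i) (M : ℕ) :
    HasSum (fun i => lam i ^ (M + 2))
      (∫ V : Fin (M + 2) → X, ∏ t, K (V t) (V (t + 1)) ∂(Measure.pi fun _ => μ)) := by
  have h := hasSum_pow_integral_iterate_diag hK hC hsymm hA hb hlam M
  set κ : (X → ℝ) → X → ℝ := fun f w => ∫ z, K w z * f z ∂μ with hκ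
  have hc := integral_cyclic_eq_integral_iterate (ρ := μ) hK.measurable hC M 0 (F := fun _ => (1 : ℝ))
    (G := fun _ => (1 : ℝ)) measurable_const measurable_const (BF := 1) (BG := 1) (by simp) (by simp)
    ⟨1, by omega⟩ rfl
  simp only [one_mul] at hc
  have hc2 : ∀ x, (κ^[0 + 1]) (fun y => (κ^[M]) (fun z => K z x) y) x = (κ^[M + 1]) (fun z => K z x) x := by
    intro x
    have e : (fun y => (κ^[M]) (fun z => K z x) y) = (κ^[M]) (fun z => K z x) := rfl
    rw [e, ← Function.iterate_add_apply, show 0 + 1 + M = M + 1 by omega]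
  have hc' : ∫ V : Fin (M + 2) → X, ∏ t, K (V t) (V (t + 1)) ∂(Measure.pi fun _ => μ) =
      ∫ x, (κ^[M + 1]) (fun z => K z x) x ∂μ :=
    calc ∫ V : Fin (M + 2) → X, ∏ t, K (V t) (V (t + 1)) ∂(Measure.pi fun _ => μ)
          = ∫ x, (κ^[0 + 1]) (fun y => (κ^[M]) (fun z => K z x) y) x ∂μ := hc
      _ = ∫ x, (κ^[M + 1]) (fun z => K z x) x ∂μ := integral_congr_ae (ae_of_all _ hc2)
  rw [hc']
  exact h

end Literature.Analysis.OperatorTheory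

end
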